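import Literature.NumberTheory.Sieve.SmoothTernaryHolder
import HarnessLib

/-!
# Hölder–restriction for ternary friable sums with a non-unit dilation (multiplicity factor)

Topic `Literature/NumberTheory/Sieve`; a PROVED file, sequel of `SmoothTernaryHolder.lean`
(`ternary_holder_restriction`, the crude Hölder `(5/2, 5/2, 5)` + restriction bound of
[Harper2016, Theorem 2 and §5] for `∑_{r ∈ T} |V₁(d₁r/N₀)| |V₂(d₂r/N₀)| |V₃(d₃r/N₀)|` with dilations
`d_i` coprime to the number `N₀` of sample points). Here the coprimality of the dilations of the two
class-restricted factors is relaxed to a MULTIPLICITY: `N₀ = g_i N_i` and `d_i = g_i d_i'` with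
`(d_i', N_i) = 1` (`i = 1, 2`), at the price of the factor `g_i^{2/5}` in the bound (the oversampling
factor `(1 + N₀/x_i)^{2/5}` becomes `(g_i (1 + N_i/x_i))^{2/5}`).

* `TernaryHolder.sum_fourierChar_dilate_add_period`: `V(d (r + N₁)/N₁) = V(d r/N₁)` (the phases
  `e(n d r/N₁)` are `N₁`-periodic in `r`);
* `TernaryHolder.sum_le_mul_sum_of_periodic`: for `G ≥ 0` `N₁`-periodic and `T ⊆ [0, g N₁)`,
  `∑_{r ∈ T} G(r) ≤ g ∑_{r < N₁} G(r)`;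
* `TernaryHolder.sum_mult_dilate_norm_rpow_le`: for `N₀ = g N₁`, `(d, N₁) = 1`, `T ⊆ [0, N₀)`, a bound
  `B` for the full moment `∑_{k < N₁} |V(k/N₁)|^p` gives `∑_{r ∈ T} |V((g d) r/N₀)|^p ≤ g B`
  (`(g d) r/N₀ = d r/N₁`, periodicity, and the unit-dilation step `sum_dilate_norm_rpow_le` of
  `SmoothTernaryHolder.lean` at modulus `N₁`);
* `ternary_holder_restriction_mult_of_eq`: the ternary bound with multiplicities `g₁, g₂` on the
  factors `1, 2` (`N₀ = g₁N₁ = g₂N₂`, `d₁ = g₁d₁'`, `d₂ = g₂d₂'`, `(d₁', N₁) = (d₂', N₂) = (d₃, N₀) = 1`),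
  the left-hand side being literally that of `ternary_holder_restriction`;
* `ternary_holder_restriction_mult`: the specialisation `N₀ = g N₁`, `d₁ = g d₁'`, `g₂ = 1`
  (multiplicity on the first factor only), and `ternary_holder_restriction_mult_snd`: the symmetric
  specialisation `g₁ = 1`, `d₂ = g d₂'` (multiplicity on the second factor only).

Use (circle method for friable solutions of `d₁n₁ ± d₂n₂ = d₃n₃` in residue classes): when the
sample modulus has to be `N₀ = q N₁` while the dilation of a class-restricted variable is `D q^v`
(`v ≥ 1`, `(D q^{v-1}, N₁) = 1`), the dilation is not a unit modulo `N₀` but `g = q` works.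

## References

* A. J. Harper, *Minor arcs, mean values, and restriction theory for exponential sums over smooth
  numbers*, Compositio Math. 152 (2016) 1121–1158, Theorem 2 and §5 [Harper2016].
-/

noncomputable section

open Finset Real
open scoped FourierTransform

namespace Literature.NumberTheory.Sieve

namespace TernaryHolder

/-! ### Periodicity in the sample point and multiplicity -/

/-- **The dilated sum is `N₁`-periodic in the sample point**: for `N₁ ≥ 1`, `d ∈ ℤ` and `r ∈ ℕ`,
`∑_n a(n) e(n d (r + N₁)/N₁) = ∑_n a(n) e(n d r/N₁)`, because both phases reduce to
`e(n k/N₁)` with `k = (d r) mod N₁ = (d (r + N₁)) mod N₁` (`fourierChar_dilate_eq`). [folklore] -/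
theorem sum_fourierChar_dilate_add_period {N₁ : ℕ} (hN₁ : 1 ≤ N₁) (d : ℤ) (r : ℕ) (S : Finset ℕ)
    (a : ℕ → ℂ) :
    ∑ n ∈ S, a n * (𝐞 ((n : ℝ) * ((d * (r + N₁ : ℕ) : ℝ) / N₁)) : ℂ) =
      ∑ n ∈ S, a n * (𝐞 ((n : ℝ) * ((d * r : ℝ) / N₁)) : ℂ) := by
  refine Finset.sum_congr rfl fun n _ => ?_
  rw [fourierChar_dilate_eq hN₁ d (r + N₁) n, fourierChar_dilate_eq hN₁ d r n, Nat.cast_add, mul_add,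
    Int.add_mul_emod_self_right]

/-- **Sums of a periodic non-negative sequence over part of `g` periods**: if `G ≥ 0` on `ℕ` is
`N₁`-periodic and `T ⊆ [0, g N₁)`, then `∑_{r ∈ T} G(r) ≤ g ∑_{r < N₁} G(r)` (enlarge `T` to the
`g` full periods `[0, g N₁)`, each contributing `∑_{r < N₁} G(r)`). [folklore] -/
theorem sum_le_mul_sum_of_periodic {G : ℕ → ℝ} {N₁ : ℕ} (hG : ∀ r, 0 ≤ G r)
    (hper : ∀ r, G (r + N₁) = G r) {g : ℕ} {T : Finset ℕ} (hT : T ⊆ Finset.range (g * N₁)) :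
    ∑ r ∈ T, G r ≤ g * ∑ r ∈ Finset.range N₁, G r := by
  -- `G (m N₁ + r) = G r`
  have hshift : ∀ m r : ℕ, G (m * N₁ + r) = G r := by
    intro m r
    induction m with
    | zero => rw [zero_mul, zero_add]
    | succ m ih => rw [add_one_mul, show m * N₁ + N₁ + r = m * N₁ + r + N₁ by ring, hper, ih]
  -- `∑_{r < m N₁} G r = m ∑_{r < N₁} G r`
  have hfull : ∀ m : ℕ, ∑ r ∈ Finset.range (m * N₁), G r = m * ∑ r ∈ Finset.range N₁, G r := by
    intro m
    induction m with
    | zero => simp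
    | succ m ih =>
      rw [add_one_mul, Finset.sum_range_add, ih, Finset.sum_congr rfl fun r _ => hshift m r]
      push_cast
      ring
  calc ∑ r ∈ T, G r ≤ ∑ r ∈ Finset.range (g * N₁), G r :=
        Finset.sum_le_sum_of_subset_of_nonneg hT fun r _ _ => hG r
    _ = _ := hfull g

/-- **Restriction on a dilated sub-grid with multiplicity.** Let `N₀ = g N₁` with `N₁ ≥ 1`,
`(d, N₁) = 1` and `T ⊆ [0, N₀)`. A bound `∑_{k < N₁} |V(k/N₁)|^p ≤ B` for the full moment at level
`N₁` (`V(θ) = ∑_{n ∈ S} a(n) e(nθ)`) gives `∑_{r ∈ T} |V((g d) r/N₀)|^p ≤ g B`: indeed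
`(g d) r/N₀ = d r/N₁`, the summand is `N₁`-periodic in `r` (`sum_fourierChar_dilate_add_period`), so
the sum over `T` is at most `g` full periods (`sum_le_mul_sum_of_periodic`), and one full period
`∑_{r < N₁} |V(d r/N₁)|^p` is `≤ B` by the unit-dilation step `sum_dilate_norm_rpow_le` at modulus
`N₁`. For `g = 1` this is `sum_dilate_norm_rpow_le`. [folklore] -/
theorem sum_mult_dilate_norm_rpow_le {N₀ g N₁ : ℕ} (hN : N₀ = g * N₁) (hN₁ : 1 ≤ N₁) {d : ℤ}
    (hd : IsCoprime d N₁) {T : Finset ℕ} (hT : T ⊆ Finset.range N₀) (S : Finset ℕ) (a : ℕ → ℂ)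
    (p : ℝ) {B : ℝ}
    (hB : ∑ k ∈ Finset.range N₁,
        ‖∑ n ∈ S, a n * (𝐞 ((n : ℝ) * (0 + (k : ℝ) / N₁)) : ℂ)‖ ^ p ≤ B) :
    ∑ r ∈ T, ‖∑ n ∈ S, a n * (𝐞 ((n : ℝ) * ((((g : ℤ) * d : ℤ) * r : ℝ) / N₀)) : ℂ)‖ ^ p ≤
      g * B := by
  rcases Nat.eq_zero_or_pos g with rfl | hg
  · -- `N₀ = 0`, `T = ∅`
    have hT0 : T = ∅ := by
      rw [hN, zero_mul, Finset.range_zero] at hT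
      exact Finset.subset_empty.mp hT
    simp [hT0]
  have hgr : (g : ℝ) ≠ 0 := by positivity
  have hN₁r : (N₁ : ℝ) ≠ 0 := by positivity
  -- `(g d) r/N₀ = d r/N₁`
  have hphase : ∀ r : ℕ, ((((g : ℤ) * d : ℤ) * r : ℝ) / N₀) = ((d * r : ℝ) / N₁) := by
    intro r
    rw [hN]
    push_cast
    field_simp
  simp_rw [hphase]
  have hper := fun r : ℕ =>
    congrArg (fun z : ℂ => ‖z‖ ^ p) (sum_fourierChar_dilate_add_period hN₁ d r S a)
  refine (sum_le_mul_sum_of_periodic (G := fun r : ℕ =>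
    ‖∑ n ∈ S, a n * (𝐞 ((n : ℝ) * ((d * r : ℝ) / N₁)) : ℂ)‖ ^ p) (fun r => by positivity) hper
    (hN ▸ hT)).trans ?_
  exact mul_le_mul_of_nonneg_left (sum_dilate_norm_rpow_le hN₁ hd (subset_refl _) S a p hB)
    (Nat.cast_nonneg g)

end TernaryHolder

open TernaryHolder in
/-- **Hölder `(5/2, 5/2, 5)` and oversampled restriction for a ternary product of friable exponential
sums, with multiplicities on the first two dilations.** Same setting as `ternary_holder_restriction`
(`𝓟(x) = x^{α} ζ(α,y)/√φ₂(α,y)`, `V_i(θ) = ∑_{n ∈ S(x_i,y)} a_i(n) e(nθ)`, `|a_i(n)| ≤ 1`, Harper's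
regime at the three scales `x₁, x₂, x₃`, `N₀ ≥ 1` sample points, `T ⊆ [0, N₀)`,
`S₃ ≥ sup_{r ∈ T} |V₃(d₃ r/N₀)|`, `(d₃, N₀) = 1`), but the dilations of the first two factors need
not be units modulo `N₀`: it suffices that `N₀ = g₁ N₁ = g₂ N₂`, `d₁ = g₁ d₁'`, `d₂ = g₂ d₂'` with
`(d₁', N₁) = (d₂', N₂) = 1`, and then
`∑_{r ∈ T} |V₁(d₁r/N₀)| |V₂(d₂r/N₀)| |V₃(d₃r/N₀)| ≤ C (log x₁ log x₂ log x₃)^8 (g₁(1+N₁/x₁))^{2/5}`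
`(g₂(1+N₂/x₂))^{2/5} (1+N₀/x₃)^{1/5} 𝓟(x₁) 𝓟(x₂) 𝓟(x₃)^{1/2} S₃^{1/2}`.
Proof: as for `ternary_holder_restriction` (Hölder `(5/2, 5/2, 5)`, `|V₃|^5 ≤ S₃^{5/2} |V₃|^{5/2}`,
`assemble`), the moments of the factors `i = 1, 2` being bounded by
`g_i · C (log x_i)^{19} (1 + N_i/x_i) 𝓟(x_i)^{5/2}`: `d_i r/N₀ = d_i' r/N_i` is `N_i`-periodic in `r`,
`[0, N₀)` consists of `g_i` periods, and on one period the unit dilation `d_i'` permutes the grid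
`{k/N_i}` (`sum_mult_dilate_norm_rpow_le` and `discreteRestriction_five_halves_oversampled` at `N_i`,
`θ₀ = 0`). The left-hand side is literally that of `ternary_holder_restriction`, which is the case
`g₁ = g₂ = 1`. [cite: Harper2016, Theorem 2 and §5] -/
theorem ternary_holder_restriction_mult_of_eq :
    ∃ C x₀ : ℝ, 0 < C ∧ ∀ (y : ℕ) (x₁ x₂ x₃ : ℝ),
      x₀ ≤ x₁ → Real.log x₁ ^ 8 ≤ (y : ℝ) → Real.log (y : ℝ) ≤ 1 / 2 * Real.log x₁ ^ (1 / 6 : ℝ) →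
      (y : ℝ) ^ 200 ≤ x₁ → 1 - 1 / 10000 ≤ saddlePoint x₁ y →
      x₁ ^ ((39999 : ℝ) / 40000) ≤ ((Nat.smoothNumbersUpTo ⌊x₁⌋₊ (y + 1)).card : ℝ) →
      x₀ ≤ x₂ → Real.log x₂ ^ 8 ≤ (y : ℝ) → Real.log (y : ℝ) ≤ 1 / 2 * Real.log x₂ ^ (1 / 6 : ℝ) →
      (y : ℝ) ^ 200 ≤ x₂ → 1 - 1 / 10000 ≤ saddlePoint x₂ y →
      x₂ ^ ((39999 : ℝ) / 40000) ≤ ((Nat.smoothNumbersUpTo ⌊x₂⌋₊ (y + 1)).card : ℝ) →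
      x₀ ≤ x₃ → Real.log x₃ ^ 8 ≤ (y : ℝ) → Real.log (y : ℝ) ≤ 1 / 2 * Real.log x₃ ^ (1 / 6 : ℝ) →
      (y : ℝ) ^ 200 ≤ x₃ → 1 - 1 / 10000 ≤ saddlePoint x₃ y →
      x₃ ^ ((39999 : ℝ) / 40000) ≤ ((Nat.smoothNumbersUpTo ⌊x₃⌋₊ (y + 1)).card : ℝ) →
      ∀ (N₀ : ℕ), 1 ≤ N₀ → ∀ (g₁ N₁ g₂ N₂ : ℕ), N₀ = g₁ * N₁ → N₀ = g₂ * N₂ →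
      ∀ (d₁ d₁' d₂ d₂' d₃ : ℤ), d₁ = g₁ * d₁' → IsCoprime d₁' (N₁ : ℤ) → d₂ = g₂ * d₂' →
      IsCoprime d₂' (N₂ : ℤ) → IsCoprime d₃ (N₀ : ℤ) →
      ∀ (a₁ a₂ a₃ : ℕ → ℂ), (∀ n, ‖a₁ n‖ ≤ 1) → (∀ n, ‖a₂ n‖ ≤ 1) → (∀ n, ‖a₃ n‖ ≤ 1) →
      ∀ (T : Finset ℕ), T ⊆ Finset.range N₀ → ∀ (S₃ : ℝ), 0 ≤ S₃ →
      (∀ r ∈ T, ‖∑ n ∈ Nat.smoothNumbersUpTo ⌊x₃⌋₊ (y + 1),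
          a₃ n * (𝐞 ((n : ℝ) * ((d₃ * r : ℝ) / N₀)) : ℂ)‖ ≤ S₃) →
        ∑ r ∈ T,
          ‖∑ n ∈ Nat.smoothNumbersUpTo ⌊x₁⌋₊ (y + 1), a₁ n * (𝐞 ((n : ℝ) * ((d₁ * r : ℝ) / N₀)) : ℂ)‖ *
          ‖∑ n ∈ Nat.smoothNumbersUpTo ⌊x₂⌋₊ (y + 1), a₂ n * (𝐞 ((n : ℝ) * ((d₂ * r : ℝ) / N₀)) : ℂ)‖ *
          ‖∑ n ∈ Nat.smoothNumbersUpTo ⌊x₃⌋₊ (y + 1), a₃ n * (𝐞 ((n : ℝ) * ((d₃ * r : ℝ) / N₀)) : ℂ)‖ ≤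
        C * (Real.log x₁ * Real.log x₂ * Real.log x₃) ^ (8 : ℕ) *
          ((g₁ : ℝ) * (1 + (N₁ : ℝ) / x₁)) ^ (2 / 5 : ℝ) * ((g₂ : ℝ) * (1 + (N₂ : ℝ) / x₂)) ^ (2 / 5 : ℝ) *
          (1 + (N₀ : ℝ) / x₃) ^ (1 / 5 : ℝ) *
          (x₁ ^ saddlePoint x₁ y *
            (smoothZeta (saddlePoint x₁ y) y / Real.sqrt (saddlePhi₂ (saddlePoint x₁ y) y))) *
          (x₂ ^ saddlePoint x₂ y *
            (smoothZeta (saddlePoint x₂ y) y / Real.sqrt (saddlePhi₂ (saddlePoint x₂ y) y))) *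
          (x₃ ^ saddlePoint x₃ y *
            (smoothZeta (saddlePoint x₃ y) y / Real.sqrt (saddlePhi₂ (saddlePoint x₃ y) y))) ^
              (1 / 2 : ℝ) *
          S₃ ^ (1 / 2 : ℝ) := by
  obtain ⟨C, x₀, hC, hR⟩ := discreteRestriction_five_halves_oversampled
  refine ⟨C, max x₀ 3, hC, ?_⟩
  intro y x₁ x₂ x₃ hx₁ hy8₁ hy6₁ hy200₁ hα₁ hΨ₁ hx₂ hy8₂ hy6₂ hy200₂ hα₂ hΨ₂ hx₃ hy8₃ hy6₃ hy200₃ hα₃ hΨ₃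
    N₀ hN₀ g₁ N₁ g₂ N₂ hgN₁ hgN₂ d₁ d₁' d₂ d₂' d₃ hd₁ hd₁' hd₂ hd₂' hd₃ a₁ a₂ a₃ ha₁ ha₂ ha₃ T hT S₃ hS₃
    hsup
  subst hd₁ hd₂
  rw [max_le_iff] at hx₁ hx₂ hx₃
  have hx₁0 : 0 < x₁ := by linarith [hx₁.2]
  have hx₂0 : 0 < x₂ := by linarith [hx₂.2]
  have hx₃0 : 0 < x₃ := by linarith [hx₃.2]
  have hN₁ : 1 ≤ N₁ := Nat.pos_of_mul_pos_left (a := g₁) (by rw [← hgN₁]; omega)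
  have hN₂ : 1 ≤ N₂ := Nat.pos_of_mul_pos_left (a := g₂) (by rw [← hgN₂]; omega)
  -- `log x ≥ 1` for `x ≥ 3 > e`
  have hlog : ∀ {x : ℝ}, 3 ≤ x → 1 ≤ Real.log x := fun hx => by
    rw [Real.le_log_iff_exp_le (by linarith)]
    have := Real.exp_one_lt_d9
    linarith
  -- reshaping `g (C L O P) = C L (g O) P`
  have key : ∀ G K L O P : ℝ, G * (K * L * O * P) = K * L * (G * O) * P := fun G K L O P => by ring
  -- the two moment bounds with multiplicity
  have hf := sum_mult_dilate_norm_rpow_le hgN₁ hN₁ hd₁' hT _ a₁ ((5 : ℝ) / 2)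
    (hR x₁ y hx₁.1 hy8₁ hy6₁ hy200₁ hα₁ hΨ₁ N₁ hN₁ 0 a₁ ha₁)
  have hg := sum_mult_dilate_norm_rpow_le hgN₂ hN₂ hd₂' hT _ a₂ ((5 : ℝ) / 2)
    (hR x₂ y hx₂.1 hy8₂ hy6₂ hy200₂ hα₂ hΨ₂ N₂ hN₂ 0 a₂ ha₂)
  rw [key] at hf hg
  exact assemble (fun r => norm_nonneg _) (fun r => norm_nonneg _) (fun r => norm_nonneg _) hC
    (hlog hx₁.2) (hlog hx₂.2) (hlog hx₃.2)
    (by positivity) (by positivity) (by positivity)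
    (profile_pos (by linarith [hx₁.2]) hα₁).le (profile_pos (by linarith [hx₂.2]) hα₂).le
    (profile_pos (by linarith [hx₃.2]) hα₃).le hS₃ hf hg
    (sum_dilate_norm_rpow_le hN₀ hd₃ hT _ a₃ _
      (hR x₃ y hx₃.1 hy8₃ hy6₃ hy200₃ hα₃ hΨ₃ N₀ hN₀ 0 a₃ ha₃))
    hsup

/-- **Hölder `(5/2, 5/2, 5)` and oversampled restriction for a ternary product of friable exponential
sums, with a multiplicity on the first dilation.** With `𝓟(x) = x^{α} ζ(α,y)/√φ₂(α,y)`
(`α = α(x,y)`) and `V_i(θ) = ∑_{n ∈ S(x_i,y)} a_i(n) e(nθ)`, `|a_i(n)| ≤ 1`, in Harper's regime at each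
of the three scales `x₁, x₂, x₃` (`x_i ≥ x₀`, `(log x_i)^8 ≤ y`, `log y ≤ ½ (log x_i)^{1/6}`,
`y^{200} ≤ x_i`, `α(x_i,y) ≥ 1 − 10⁻⁴`, `Ψ(x_i,y) ≥ x_i^{39999/40000}`): for all `g, N₁ ≥ 1`
(`N₀ = g N₁` sample points), dilations `g d₁'`, `d₂`, `d₃` with `(d₁', N₁) = 1`,
`(d₂, g N₁) = (d₃, g N₁) = 1`, every `T ⊆ [0, g N₁)` and every `S₃ ≥ sup_{r ∈ T} |V₃(d₃ r/(g N₁))|`,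
`∑_{r ∈ T} |V₁(g d₁' r/(g N₁))| |V₂(d₂ r/(g N₁))| |V₃(d₃ r/(g N₁))| ≤ C (log x₁ log x₂ log x₃)^8`
`(g (1+N₁/x₁))^{2/5} (1+gN₁/x₂)^{2/5} (1+gN₁/x₃)^{1/5} 𝓟(x₁) 𝓟(x₂) 𝓟(x₃)^{1/2} S₃^{1/2}`.
The case `g₁ = g`, `g₂ = 1`, `N₂ = N₀ = g N₁` of `ternary_holder_restriction_mult_of_eq`. The
statement is symmetric under `(x₁, g d₁', a₁) ↔ (x₂, d₂, a₂)` up to the order of the factors, so it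
also serves a multiplicity on the second factor (or use `ternary_holder_restriction_mult_of_eq` with
`g₁ = 1`). [cite: Harper2016, Theorem 2 and §5] -/
theorem ternary_holder_restriction_mult :
    ∃ C x₀ : ℝ, 0 < C ∧ ∀ (y : ℕ) (x₁ x₂ x₃ : ℝ),
      x₀ ≤ x₁ → Real.log x₁ ^ 8 ≤ (y : ℝ) → Real.log (y : ℝ) ≤ 1 / 2 * Real.log x₁ ^ (1 / 6 : ℝ) →
      (y : ℝ) ^ 200 ≤ x₁ → 1 - 1 / 10000 ≤ saddlePoint x₁ y →
      x₁ ^ ((39999 : ℝ) / 40000) ≤ ((Nat.smoothNumbersUpTo ⌊x₁⌋₊ (y + 1)).card : ℝ) →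
      x₀ ≤ x₂ → Real.log x₂ ^ 8 ≤ (y : ℝ) → Real.log (y : ℝ) ≤ 1 / 2 * Real.log x₂ ^ (1 / 6 : ℝ) →
      (y : ℝ) ^ 200 ≤ x₂ → 1 - 1 / 10000 ≤ saddlePoint x₂ y →
      x₂ ^ ((39999 : ℝ) / 40000) ≤ ((Nat.smoothNumbersUpTo ⌊x₂⌋₊ (y + 1)).card : ℝ) →
      x₀ ≤ x₃ → Real.log x₃ ^ 8 ≤ (y : ℝ) → Real.log (y : ℝ) ≤ 1 / 2 * Real.log x₃ ^ (1 / 6 : ℝ) →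
      (y : ℝ) ^ 200 ≤ x₃ → 1 - 1 / 10000 ≤ saddlePoint x₃ y →
      x₃ ^ ((39999 : ℝ) / 40000) ≤ ((Nat.smoothNumbersUpTo ⌊x₃⌋₊ (y + 1)).card : ℝ) →
      ∀ (g N₁ : ℕ), 1 ≤ g → 1 ≤ N₁ → ∀ (d₁' d₂ d₃ : ℤ), IsCoprime d₁' (N₁ : ℤ) →
      IsCoprime d₂ ((g * N₁ : ℕ) : ℤ) → IsCoprime d₃ ((g * N₁ : ℕ) : ℤ) →
      ∀ (a₁ a₂ a₃ : ℕ → ℂ), (∀ n, ‖a₁ n‖ ≤ 1) → (∀ n, ‖a₂ n‖ ≤ 1) → (∀ n, ‖a₃ n‖ ≤ 1) →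
      ∀ (T : Finset ℕ), T ⊆ Finset.range (g * N₁) → ∀ (S₃ : ℝ), 0 ≤ S₃ →
      (∀ r ∈ T, ‖∑ n ∈ Nat.smoothNumbersUpTo ⌊x₃⌋₊ (y + 1),
          a₃ n * (𝐞 ((n : ℝ) * ((d₃ * r : ℝ) / ((g * N₁ : ℕ) : ℝ))) : ℂ)‖ ≤ S₃) →
        ∑ r ∈ T,
          ‖∑ n ∈ Nat.smoothNumbersUpTo ⌊x₁⌋₊ (y + 1),
              a₁ n * (𝐞 ((n : ℝ) * ((((g : ℤ) * d₁' : ℤ) * r : ℝ) / ((g * N₁ : ℕ) : ℝ))) : ℂ)‖ *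
          ‖∑ n ∈ Nat.smoothNumbersUpTo ⌊x₂⌋₊ (y + 1),
              a₂ n * (𝐞 ((n : ℝ) * ((d₂ * r : ℝ) / ((g * N₁ : ℕ) : ℝ))) : ℂ)‖ *
          ‖∑ n ∈ Nat.smoothNumbersUpTo ⌊x₃⌋₊ (y + 1),
              a₃ n * (𝐞 ((n : ℝ) * ((d₃ * r : ℝ) / ((g * N₁ : ℕ) : ℝ))) : ℂ)‖ ≤
        C * (Real.log x₁ * Real.log x₂ * Real.log x₃) ^ (8 : ℕ) *
          ((g : ℝ) * (1 + (N₁ : ℝ) / x₁)) ^ (2 / 5 : ℝ) *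
          (1 + ((g * N₁ : ℕ) : ℝ) / x₂) ^ (2 / 5 : ℝ) * (1 + ((g * N₁ : ℕ) : ℝ) / x₃) ^ (1 / 5 : ℝ) *
          (x₁ ^ saddlePoint x₁ y *
            (smoothZeta (saddlePoint x₁ y) y / Real.sqrt (saddlePhi₂ (saddlePoint x₁ y) y))) *
          (x₂ ^ saddlePoint x₂ y *
            (smoothZeta (saddlePoint x₂ y) y / Real.sqrt (saddlePhi₂ (saddlePoint x₂ y) y))) *
          (x₃ ^ saddlePoint x₃ y *
            (smoothZeta (saddlePoint x₃ y) y / Real.sqrt (saddlePhi₂ (saddlePoint x₃ y) y))) ^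
              (1 / 2 : ℝ) *
          S₃ ^ (1 / 2 : ℝ) := by
  obtain ⟨C, x₀, hC, h⟩ := ternary_holder_restriction_mult_of_eq
  refine ⟨C, x₀, hC, ?_⟩
  intro y x₁ x₂ x₃ hx₁ hy8₁ hy6₁ hy200₁ hα₁ hΨ₁ hx₂ hy8₂ hy6₂ hy200₂ hα₂ hΨ₂ hx₃ hy8₃ hy6₃ hy200₃ hα₃ hΨ₃
    g N₁ hg hN₁ d₁' d₂ d₃ hd₁' hd₂ hd₃ a₁ a₂ a₃ ha₁ ha₂ ha₃ T hT S₃ hS₃ hsup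
  have hN₀ : 1 ≤ g * N₁ := by
    have := Nat.mul_le_mul hg hN₁
    rwa [one_mul] at this
  have := h y x₁ x₂ x₃ hx₁ hy8₁ hy6₁ hy200₁ hα₁ hΨ₁ hx₂ hy8₂ hy6₂ hy200₂ hα₂ hΨ₂ hx₃ hy8₃ hy6₃ hy200₃
    hα₃ hΨ₃ (g * N₁) hN₀ g N₁ 1 (g * N₁) rfl (one_mul _).symm ((g : ℤ) * d₁') d₁' d₂ d₂ d₃ rfl hd₁'
    (by rw [Nat.cast_one, one_mul]) hd₂ hd₃ a₁ a₂ a₃ ha₁ ha₂ ha₃ T hT S₃ hS₃ hsup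
  simpa only [Nat.cast_one, one_mul] using this

/-- **Hölder `(5/2, 5/2, 5)` and oversampled restriction for a ternary product of friable exponential
sums, with a multiplicity on the second dilation** (the variant of `ternary_holder_restriction_mult`
symmetric under `(x₁, d₁, a₁) ↔ (x₂, d₂, a₂)`): in Harper's regime at the three scales, for all
`g, N₁ ≥ 1`, dilations `d₁`, `g d₂'`, `d₃` with `(d₁, g N₁) = 1`, `(d₂', N₁) = 1`, `(d₃, g N₁) = 1`,
every `T ⊆ [0, g N₁)` and every `S₃ ≥ sup_{r ∈ T} |V₃(d₃ r/(g N₁))|`,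
`∑_{r ∈ T} |V₁(d₁ r/(g N₁))| |V₂(g d₂' r/(g N₁))| |V₃(d₃ r/(g N₁))| ≤ C (log x₁ log x₂ log x₃)^8`
`(1+gN₁/x₁)^{2/5} (g (1+N₁/x₂))^{2/5} (1+gN₁/x₃)^{1/5} 𝓟(x₁) 𝓟(x₂) 𝓟(x₃)^{1/2} S₃^{1/2}`.
The case `g₁ = 1`, `N₁ = N₀ = g N₁`, `g₂ = g` of `ternary_holder_restriction_mult_of_eq`.
[cite: Harper2016, Theorem 2 and §5] -/
theorem ternary_holder_restriction_mult_snd :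
    ∃ C x₀ : ℝ, 0 < C ∧ ∀ (y : ℕ) (x₁ x₂ x₃ : ℝ),
      x₀ ≤ x₁ → Real.log x₁ ^ 8 ≤ (y : ℝ) → Real.log (y : ℝ) ≤ 1 / 2 * Real.log x₁ ^ (1 / 6 : ℝ) →
      (y : ℝ) ^ 200 ≤ x₁ → 1 - 1 / 10000 ≤ saddlePoint x₁ y →
      x₁ ^ ((39999 : ℝ) / 40000) ≤ ((Nat.smoothNumbersUpTo ⌊x₁⌋₊ (y + 1)).card : ℝ) →
      x₀ ≤ x₂ → Real.log x₂ ^ 8 ≤ (y : ℝ) → Real.log (y : ℝ) ≤ 1 / 2 * Real.log x₂ ^ (1 / 6 : ℝ) →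
      (y : ℝ) ^ 200 ≤ x₂ → 1 - 1 / 10000 ≤ saddlePoint x₂ y →
      x₂ ^ ((39999 : ℝ) / 40000) ≤ ((Nat.smoothNumbersUpTo ⌊x₂⌋₊ (y + 1)).card : ℝ) →
      x₀ ≤ x₃ → Real.log x₃ ^ 8 ≤ (y : ℝ) → Real.log (y : ℝ) ≤ 1 / 2 * Real.log x₃ ^ (1 / 6 : ℝ) →
      (y : ℝ) ^ 200 ≤ x₃ → 1 - 1 / 10000 ≤ saddlePoint x₃ y →
      x₃ ^ ((39999 : ℝ) / 40000) ≤ ((Nat.smoothNumbersUpTo ⌊x₃⌋₊ (y + 1)).card : ℝ) →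
      ∀ (g N₁ : ℕ), 1 ≤ g → 1 ≤ N₁ → ∀ (d₁ d₂' d₃ : ℤ), IsCoprime d₁ ((g * N₁ : ℕ) : ℤ) →
      IsCoprime d₂' (N₁ : ℤ) → IsCoprime d₃ ((g * N₁ : ℕ) : ℤ) →
      ∀ (a₁ a₂ a₃ : ℕ → ℂ), (∀ n, ‖a₁ n‖ ≤ 1) → (∀ n, ‖a₂ n‖ ≤ 1) → (∀ n, ‖a₃ n‖ ≤ 1) →
      ∀ (T : Finset ℕ), T ⊆ Finset.range (g * N₁) → ∀ (S₃ : ℝ), 0 ≤ S₃ →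
      (∀ r ∈ T, ‖∑ n ∈ Nat.smoothNumbersUpTo ⌊x₃⌋₊ (y + 1),
          a₃ n * (𝐞 ((n : ℝ) * ((d₃ * r : ℝ) / ((g * N₁ : ℕ) : ℝ))) : ℂ)‖ ≤ S₃) →
        ∑ r ∈ T,
          ‖∑ n ∈ Nat.smoothNumbersUpTo ⌊x₁⌋₊ (y + 1),
              a₁ n * (𝐞 ((n : ℝ) * ((d₁ * r : ℝ) / ((g * N₁ : ℕ) : ℝ))) : ℂ)‖ *
          ‖∑ n ∈ Nat.smoothNumbersUpTo ⌊x₂⌋₊ (y + 1),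
              a₂ n * (𝐞 ((n : ℝ) * ((((g : ℤ) * d₂' : ℤ) * r : ℝ) / ((g * N₁ : ℕ) : ℝ))) : ℂ)‖ *
          ‖∑ n ∈ Nat.smoothNumbersUpTo ⌊x₃⌋₊ (y + 1),
              a₃ n * (𝐞 ((n : ℝ) * ((d₃ * r : ℝ) / ((g * N₁ : ℕ) : ℝ))) : ℂ)‖ ≤
        C * (Real.log x₁ * Real.log x₂ * Real.log x₃) ^ (8 : ℕ) *
          (1 + ((g * N₁ : ℕ) : ℝ) / x₁) ^ (2 / 5 : ℝ) * ((g : ℝ) * (1 + (N₁ : ℝ) / x₂)) ^ (2 / 5 : ℝ) *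
          (1 + ((g * N₁ : ℕ) : ℝ) / x₃) ^ (1 / 5 : ℝ) *
          (x₁ ^ saddlePoint x₁ y *
            (smoothZeta (saddlePoint x₁ y) y / Real.sqrt (saddlePhi₂ (saddlePoint x₁ y) y))) *
          (x₂ ^ saddlePoint x₂ y *
            (smoothZeta (saddlePoint x₂ y) y / Real.sqrt (saddlePhi₂ (saddlePoint x₂ y) y))) *
          (x₃ ^ saddlePoint x₃ y *
            (smoothZeta (saddlePoint x₃ y) y / Real.sqrt (saddlePhi₂ (saddlePoint x₃ y) y))) ^
              (1 / 2 : ℝ) *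
          S₃ ^ (1 / 2 : ℝ) := by
  obtain ⟨C, x₀, hC, h⟩ := ternary_holder_restriction_mult_of_eq
  refine ⟨C, x₀, hC, ?_⟩
  intro y x₁ x₂ x₃ hx₁ hy8₁ hy6₁ hy200₁ hα₁ hΨ₁ hx₂ hy8₂ hy6₂ hy200₂ hα₂ hΨ₂ hx₃ hy8₃ hy6₃ hy200₃ hα₃ hΨ₃
    g N₁ hg hN₁ d₁ d₂' d₃ hd₁ hd₂' hd₃ a₁ a₂ a₃ ha₁ ha₂ ha₃ T hT S₃ hS₃ hsup
  have hN₀ : 1 ≤ g * N₁ := by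
    have := Nat.mul_le_mul hg hN₁
    rwa [one_mul] at this
  have := h y x₁ x₂ x₃ hx₁ hy8₁ hy6₁ hy200₁ hα₁ hΨ₁ hx₂ hy8₂ hy6₂ hy200₂ hα₂ hΨ₂ hx₃ hy8₃ hy6₃ hy200₃
    hα₃ hΨ₃ (g * N₁) hN₀ 1 (g * N₁) g N₁ (one_mul _).symm rfl d₁ d₁ ((g : ℤ) * d₂') d₂' d₃
    (by rw [Nat.cast_one, one_mul]) hd₁ rfl hd₂' hd₃ a₁ a₂ a₃ ha₁ ha₂ ha₃ T hT S₃ hS₃ hsup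
  simpa only [Nat.cast_one, one_mul] using this

end Literature.NumberTheory.Sieve

end
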